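/-
Copyright (c) 2026 the pub-hodgecm-mathlib formalisation cell (harness21).  Prover seat hodgecm-mathlib-K2Liu-p02 (g7), Track B «K2-LIT» ∕ hLiu418
#184♮, #42S payer road (σ), V5-inst (f) PART 2b file 1b — the second-degree EXPONENT of an adapted Siegel unipotent as a hermitian pairing
(K2Liu-p02 (g7) bus 14:08∕14:3xZ).  THEOREMS ONLY.
-/
import Summits.HodgeConjecture.HodgeConjecture.Theorems.K2LiuDeltaSpTransportUnipotentExplicit   -- ★ p860870 ((U), `half_deltaGram_reFrame_reFrame`)
import Summits.HodgeConjecture.HodgeConjecture.Theorems.K2LiuA7ValueUnipotentPins                -- ★ p860598 (`bmat`, `gramLoc`, `bmat_mulVec_reindex`)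
import Summits.HodgeConjecture.HodgeConjecture.Theorems.K2LiuLocalSWTensorAdaptedBlocks           -- ★ `gramS_tensor`, `reindex_kronecker_mul`
import HarnessLib

/-!
# Crux `HLiu418`, (σ) V5-inst (f), file 1b: THE EXPONENT OF `n(T)` IS `im( b^σ · S₀ T · b )`, AND AT THE BIG DATUM (`T = t ⊗ 1`) IT IS THE PAIRING
# `im Σᵢⱼ (S₀ t)ᵢⱼ · Gᵢⱼ` OF `S₀ t` WITH THE GRAM MATRIX `G = gramLoc b`

Cell `hodgecm-mathlib`, crux item hLiu418 = `stmt-HodgeConjecture-24832`; squad K2 ∕ K2Liu; prover K2Liu-p02 (g7).  THEOREMS ONLY (no `def`, no instance, no notation,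
no named-fact hypothesis, no `sorry`); lane `--supports stmt-HodgeConjecture-24832 --as helper`.

§1 (generic D10 `(F E c hcδ hδ hd v n T₀)`): `re_conjLocal`∕`im_conjLocal` (`re σz = re z`, `im σz = −im z`), `re_gramS_mul`∕`im_gramS_mul` (the local Gram matrix `S₀ = T₀ ⊗ 1` is real), and
**`half_deltaGram_reFrame_mulVec`**: `⅟2 · β_Δ(R b, R (T *ᵥ b)) = im( Σᵢ Σⱼ σ(bᵢ) · (S₀)ᵢⱼ · (T b)ⱼ )` (★ file 1 `half_deltaGram_reFrame_reFrame` + `im(σ(x)·y) = re x · im y − im x · re y` + symmetry of `T₀`).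
§2 (CM big datum `(e dV dW ∕ eW e′ dV′)` of ★ D-A v1, `n × M₂` matrices `bmat`): `localForm_diagonal_eq_gramS` (`J′_v = gramS (realDiagonal dV′)`), and
**`half_deltaGram_reFrame_tensor`**: for `T = reindex epsV (t ⊗ₖ 1)` (the adapted block of `tensorEmbLoc (nElem t)`, ★ `tensorEmbLoc_nElem`), with `S₀′ = reindex epsV (S₀ ⊗ₖ J′_v)` (★ `gramS_tensor`):
`⅟2 · β_Δ(R b, R (T *ᵥ b)) = im( Σ_{i j : Fin n} (S₀ t)ᵢⱼ · (gramLoc b)ᵢⱼ )` — the exponent is an `L⁺_v`-linear functional of the Gram matrix ★ p860598 `gramLoc`, linear in `t`: the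
`(t, G)`-duality behind the `hN` socket of `faceA4R_two_of_record` (file 2b picks the dual table at `n = 2`).
References: [Weil1964] n° 6, n° 13; [Kudla1994] §2–§3 Thm. 3.1; [MoeglinVignerasWaldspurger1987] Chap. 2 II.6; [KudlaRallis1994] §2.
HONEST LABEL.  Count-neutral helper: `HC_CM` is proved only modulo the 7 printed citations (2 remaining named inputs: hLiu418 = `stmt-HodgeConjecture-24832`,
h413 = `stmt-HodgeConjecture-24833`) until rung 0 closes.
-/

set_option autoImplicit false
set_option linter.dupNamespace false -- the mandated namespace repeats `HodgeConjecture.HodgeConjecture`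
set_option synthInstance.maxHeartbeats 200000 -- rectangular matrix products over the Π-type `L ⊗ L⁺_v` (as ★ p860598)

noncomputable section

open scoped Matrix Kronecker
open Matrix
open NumberField IsDedekindDomain
open Literature.NumberTheory.Automorphic Literature.NumberTheory.Automorphic.UnitaryGroup
open Literature.NumberTheory.Automorphic.UnitaryGroup.QuadraticCoordinates
open Literature.RepresentationTheory.HeisenbergGroup
open Literature.NumberTheory.GelbartRogawski1991 Literature.NumberTheory.GelbartRogawski1991.AdaptedBlocks
open Literature.NumberTheory.GelbartRogawski1991.GRConstruction
open Literature.NumberTheory.GelbartRogawski1991.UnitaryDualPair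
open Literature.NumberTheory.GelbartRogawski1991.UnitaryDualPair.LocalSplitting
open Literature.NumberTheory.K2Lit.SiegelDoubled
open Summit.HodgeConjecture.HodgeConjecture.Cruxes.HLiu418.K2LiuDeltaSpTransportSiegelLetters
open Summit.HodgeConjecture.HodgeConjecture.Cruxes.HLiu418.K2LiuDeltaModelRealFrame
open Summit.HodgeConjecture.HodgeConjecture.Cruxes.HLiu418.K2LiuDeltaSpTransportUnipotentExplicit
open Summit.HodgeConjecture.HodgeConjecture.Cruxes.HLiu418.K2LiuLocalSWSectionDefs
open Summit.HodgeConjecture.HodgeConjecture.Cruxes.HLiu418.K2LiuLocalSWTensorAdaptedBlocks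
open Summit.HodgeConjecture.HodgeConjecture.Cruxes.HLiu418.K2LiuA7ValueUnipotentPins

namespace Summit.HodgeConjecture.HodgeConjecture.Cruxes.HLiu418.K2LiuDeltaSpTransportUnipotentValue

/-! ## §1 Generic: the exponent as `im (b^σ · S₀ T · b)` -/

section Generic

variable (F : Type) [Field F] [NumberField F] (E : Type) [Field E] [NumberField E] [Algebra F E]
  [Algebra.IsQuadraticExtension F E] (c : E ≃ₐ[F] E)
  {δ : E} (hcδ : c δ = -δ) (hδ : δ ≠ 0) {d : F} (hd : δ * δ = algebraMap F E d)
  (v : HeightOneSpectrum (𝓞 F)) (n : ℕ) {T₀ : Matrix (Fin n) (Fin n) F} (hT₀ : T₀.IsSymm)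

/-- `re (σ z) = re z`. [folklore] -/
theorem re_conjLocal (z : LocalRing E v) :
    re (quadraticLocalEquiv E v c hcδ hδ).toLinearEquiv.toAddEquiv (conjLocal E c v z) = re (quadraticLocalEquiv E v c hcδ hδ).toLinearEquiv.toAddEquiv z := by
  conv_lhs => rw [← apply_re_im (quadraticLocalEquiv E v c hcδ hδ).toLinearEquiv.toAddEquiv z]
  change re _ (conjLocal E c v (quadraticLocalEquiv E v c hcδ hδ (_, _))) = _
  rw [conjLocal_quadraticLocalEquiv]
  exact re_apply _ _ _

/-- `im (σ z) = −im z`. [folklore] -/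
theorem im_conjLocal (z : LocalRing E v) :
    im (quadraticLocalEquiv E v c hcδ hδ).toLinearEquiv.toAddEquiv (conjLocal E c v z) = -im (quadraticLocalEquiv E v c hcδ hδ).toLinearEquiv.toAddEquiv z := by
  conv_lhs => rw [← apply_re_im (quadraticLocalEquiv E v c hcδ hδ).toLinearEquiv.toAddEquiv z]
  change im _ (conjLocal E c v (quadraticLocalEquiv E v c hcδ hδ (_, _))) = _
  rw [conjLocal_quadraticLocalEquiv]
  exact im_apply _ _ _

include hd in
/-- `re (S₀ᵢⱼ · w) = (T₀)ᵢⱼ · re w` — the local Gram matrix `S₀ = T₀ ⊗ 1` is real. [folklore] -/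
theorem re_gramS_mul (i j : Fin n) (w : LocalRing E v) :
    re (quadraticLocalEquiv E v c hcδ hδ).toLinearEquiv.toAddEquiv (gramS F E v n T₀ i j * w) =
      T₀.map (algebraMap F (v.adicCompletion F)) i j * re (quadraticLocalEquiv E v c hcδ hδ).toLinearEquiv.toAddEquiv w := by
  have h := isQuadraticCoordinates_local E v c hcδ hδ hd
  rw [show gramS F E v n T₀ i j = toLocalRing E v (T₀.map (algebraMap F (v.adicCompletion F)) i j) from rfl, h.re_mul, h.re_map, h.im_map,
    zero_mul, mul_zero, add_zero]

include hd in
/-- `im (S₀ᵢⱼ · w) = (T₀)ᵢⱼ · im w`. [folklore] -/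
theorem im_gramS_mul (i j : Fin n) (w : LocalRing E v) :
    im (quadraticLocalEquiv E v c hcδ hδ).toLinearEquiv.toAddEquiv (gramS F E v n T₀ i j * w) =
      T₀.map (algebraMap F (v.adicCompletion F)) i j * im (quadraticLocalEquiv E v c hcδ hδ).toLinearEquiv.toAddEquiv w := by
  have h := isQuadraticCoordinates_local E v c hcδ hδ hd
  rw [show gramS F E v n T₀ i j = toLocalRing E v (T₀.map (algebraMap F (v.adicCompletion F)) i j) from rfl, h.im_mul, h.re_map, h.im_map,
    zero_mul, add_zero]

include hd hT₀ in
/-- **THE EXPONENT AS A HERMITIAN PAIRING**: `⅟2 · β_Δ(R b, R (T *ᵥ b)) = im( Σᵢ Σⱼ σ(bᵢ) · (S₀)ᵢⱼ · (T b)ⱼ )` (`S₀ = gramS T₀`; `T₀` symmetric; `im(σ(x) y) = re x im y − im x re y`).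
[cite: Weil1964, n° 6, p. 151] [cite: Kudla1994, §3 Thm. 3.1] -/
theorem half_deltaGram_reFrame_mulVec (b : Fin n → LocalRing E v) (T : Matrix (Fin n) (Fin n) (LocalRing E v)) :
    ⅟(2 : v.adicCompletion F) *
        Matrix.toLinearMap₂' (v.adicCompletion F) (deltaGram (e₂ n) (T₀.map (algebraMap F (v.adicCompletion F))))
          (reFrame F E c hcδ hδ v n b) (reFrame F E c hcδ hδ v n (T *ᵥ b)) =
      im (quadraticLocalEquiv E v c hcδ hδ).toLinearEquiv.toAddEquiv (∑ i, ∑ j, conjLocal E c v (b i) * (gramS F E v n T₀ i j * (T *ᵥ b) j)) := by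
  have h := isQuadraticCoordinates_local E v c hcδ hδ hd
  have hMsymm : ∀ i j, T₀.map (algebraMap F (v.adicCompletion F)) i j = T₀.map (algebraMap F (v.adicCompletion F)) j i := fun i j => by
    rw [Matrix.map_apply, Matrix.map_apply, show T₀ j i = T₀ i j from by simpa using congrFun (congrFun hT₀ i) j]
  -- the right-hand side, expanded
  have hR : im (quadraticLocalEquiv E v c hcδ hδ).toLinearEquiv.toAddEquiv (∑ i, ∑ j, conjLocal E c v (b i) * (gramS F E v n T₀ i j * (T *ᵥ b) j)) =
      ∑ i, ∑ j, (re (quadraticLocalEquiv E v c hcδ hδ).toLinearEquiv.toAddEquiv (b i) * (T₀.map (algebraMap F (v.adicCompletion F)) i j * im (quadraticLocalEquiv E v c hcδ hδ).toLinearEquiv.toAddEquiv ((T *ᵥ b) j)) -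
        im (quadraticLocalEquiv E v c hcδ hδ).toLinearEquiv.toAddEquiv (b i) * (T₀.map (algebraMap F (v.adicCompletion F)) i j * re (quadraticLocalEquiv E v c hcδ hδ).toLinearEquiv.toAddEquiv ((T *ᵥ b) j))) := by
    rw [map_sum]
    refine Finset.sum_congr rfl fun i _ => ?_
    rw [map_sum]
    refine Finset.sum_congr rfl fun j _ => ?_
    rw [h.im_mul, re_conjLocal, im_conjLocal, re_gramS_mul F E c hcδ hδ hd, im_gramS_mul F E c hcδ hδ hd]
    ring
  rw [hR, half_deltaGram_reFrame_reFrame]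
  -- the left-hand side: two dot products, the second re-indexed by the symmetry of `T₀`
  simp only [dotProduct, Matrix.mulVec, Finset.mul_sum]
  have hswap : ∑ i, ∑ j, re (quadraticLocalEquiv E v c hcδ hδ).toLinearEquiv.toAddEquiv ((T *ᵥ b) i) * (T₀.map (algebraMap F (v.adicCompletion F)) i j * im (quadraticLocalEquiv E v c hcδ hδ).toLinearEquiv.toAddEquiv (b j)) =
      ∑ i, ∑ j, im (quadraticLocalEquiv E v c hcδ hδ).toLinearEquiv.toAddEquiv (b i) * (T₀.map (algebraMap F (v.adicCompletion F)) i j * re (quadraticLocalEquiv E v c hcδ hδ).toLinearEquiv.toAddEquiv ((T *ᵥ b) j)) := by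
    rw [Finset.sum_comm]
    exact Finset.sum_congr rfl fun i _ => Finset.sum_congr rfl fun j _ => by rw [hMsymm j i]; ring
  simp only [Matrix.mulVec, dotProduct] at hswap
  rw [hswap, ← Finset.sum_sub_distrib]
  exact Finset.sum_congr rfl fun i _ => (Finset.sum_sub_distrib _ _).symm

end Generic


/-! ## §2 The big datum: the exponent pairs `S₀ t` with the Gram matrix `gramLoc` -/

section CM

variable (L : Type) [Field L] [NumberField L] [IsCMField L] [Algebra.IsQuadraticExtension (Fp L) L]
  {δ : L} (hcδ : IsCMField.complexConj L δ = -δ) (hδ : δ ≠ 0) {d : Fp L} (hd : δ * δ = algebraMap (Fp L) L d)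
variable {N M n : ℕ} (e : Fin N × Fin M ≃ Fin n)
  (dV : Fin N → L) (hdV : ∀ i, IsCMField.complexConj L (dV i) = dV i)
  (dW : Fin M → L) (hdW : ∀ i, IsCMField.complexConj L (dW i) = dW i)
variable {M₂ M' n' : ℕ} (eW : Fin M × Fin M₂ ≃ Fin M') (e' : Fin N × Fin M' ≃ Fin n')
  (dV' : Fin M₂ → L) (hdV' : ∀ k, IsCMField.complexConj L (dV' k) = dV' k)
variable (v : HeightOneSpectrum (𝓞 (Fp L)))

omit [Algebra.IsQuadraticExtension (Fp L) L] in
/-- the local Gram matrix `J′_v` of `V′ = (L^{M₂}, diag dV′)` in ★ `gramLoc` equals `gramS (realDiagonal dV′)` of ★ `gramS_tensor`. [folklore] -/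
theorem localForm_diagonal_eq_gramS :
    (adelicForm L M₂ (Matrix.diagonal dV')).map (adeleToLocal L v) = LocalSplitting.gramS (Fp L) L v M₂ (realDiagonal L dV' hdV') := by
  refine Matrix.ext fun k l => ?_
  simp only [adelicForm, LocalSplitting.gramS, realDiagonal, Matrix.map_apply, Matrix.diagonal_apply]
  split_ifs with hkl
  · rw [adeleToLocal_algebraMap, IsDedekindDomain.HeightOneSpectrum.algebraMap_adicCompletion, Function.comp_apply, toLocalRing_coe]
    rfl
  · rw [map_zero, map_zero, map_zero, map_zero]

omit [Algebra.IsQuadraticExtension (Fp L) L] in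
/-- **pure algebra**: `Σ_I σ(b_I) · ((reindex epsV (H ⊗ₖ D)) *ᵥ b)_I = Σᵢⱼ Hᵢⱼ · (bmat^σ · D · bmatᵀ)ᵢⱼ`. [folklore] -/
theorem sum_conj_mul_reindex_kronecker_mulVec (H : Matrix (Fin n) (Fin n) (LocalRing L v)) (D : Matrix (Fin M₂) (Fin M₂) (LocalRing L v))
    (b : Fin n' → LocalRing L v) :
    ∑ I, conjLocal L (IsCMField.complexConj L) v (b I) * (Matrix.reindex (epsV e eW e') (epsV e eW e') (H ⊗ₖ D) *ᵥ b) I =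
      ∑ i, ∑ j, H i j * ((bmat L e eW e' v b).map (conjLocal L (IsCMField.complexConj L) v) * D * (bmat L e eW e' v b)ᵀ) i j := by
  -- re-index `I = epsV (i, k)` and expand `bmat (M *ᵥ b)`
  have hre : ∑ I, conjLocal L (IsCMField.complexConj L) v (b I) * (Matrix.reindex (epsV e eW e') (epsV e eW e') (H ⊗ₖ D) *ᵥ b) I =
      ∑ i, ∑ k, conjLocal L (IsCMField.complexConj L) v (bmat L e eW e' v b i k) *
        bmat L e eW e' v (Matrix.reindex (epsV e eW e') (epsV e eW e') (H ⊗ₖ D) *ᵥ b) i k := by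
    rw [← (epsV e eW e').sum_comp, Fintype.sum_prod_type]
    rfl
  rw [hre]
  simp only [bmat_mulVec_reindex, Matrix.kroneckerMap_apply, Matrix.mul_apply, Matrix.transpose_apply, Matrix.map_apply, Finset.mul_sum, Finset.sum_mul]
  -- both sides are `Σ i k j l, σ(b i k) · H i j · D k l · b j l` up to the order of summation and of the factors
  rw [Finset.sum_congr rfl fun i _ => Finset.sum_comm]
  refine Finset.sum_congr rfl fun i _ => Finset.sum_congr rfl fun j _ => ?_
  rw [Finset.sum_comm]
  refine Finset.sum_congr rfl fun l _ => Finset.sum_congr rfl fun k _ => ?_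
  ring

include hd hdV' in
/-- **THE EXPONENT AT THE BIG DATUM PAIRS `S₀ t` WITH THE GRAM MATRIX**: for `T = reindex epsV (t ⊗ₖ 1)` (the adapted block of `tensorEmbLoc (nElem t)`, ★ `tensorEmbLoc_nElem`),
`⅟2 · β_Δ(R b, R (T *ᵥ b)) = im( Σᵢⱼ (S₀ t)ᵢⱼ · (gramLoc b)ᵢⱼ )`, `S₀ = gramS (gramR)` the local Gram block of the SMALL datum (`(T₀′)_v = reindex epsV (S₀ ⊗ J′_v)`, ★ `gramS_tensor`).
[cite: Kudla1994, §3 Thm. 3.1] [cite: KudlaRallis1994, §2] [cite: Weil1964, n° 13] -/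
theorem half_deltaGram_reFrame_tensor (t : Matrix (Fin n) (Fin n) (LocalRing L v)) (b : Fin n' → LocalRing L v) :
    ⅟(2 : v.adicCompletion (Fp L)) *
        Matrix.toLinearMap₂' (v.adicCompletion (Fp L)) (deltaGram (e₂ n') ((gramR L e' dV hdV (tensorFrame L dW eW dV') (tensorFrame_real L dW hdW eW dV' hdV')).map (algebraMap (Fp L) (v.adicCompletion (Fp L)))))
          (reFrame (Fp L) L (IsCMField.complexConj L) hcδ hδ v n' b)
          (reFrame (Fp L) L (IsCMField.complexConj L) hcδ hδ v n' (Matrix.reindex (epsV e eW e') (epsV e eW e') (t ⊗ₖ (1 : Matrix (Fin M₂) (Fin M₂) (LocalRing L v))) *ᵥ b)) =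
      im (quadraticLocalEquiv L v (IsCMField.complexConj L) hcδ hδ).toLinearEquiv.toAddEquiv (∑ i, ∑ j, (LocalSplitting.gramS (Fp L) L v n (gramR L e dV hdV dW hdW) * t) i j * gramLoc L e eW e' dV' v b i j) := by
  rw [half_deltaGram_reFrame_mulVec (Fp L) L (IsCMField.complexConj L) hcδ hδ hd v n'
    (gramR_isSymm L e' dV hdV (tensorFrame L dW eW dV') (tensorFrame_real L dW hdW eW dV' hdV')) b]
  congr 1
  -- `Σ_I σ(b_I) Σ_J S′_IJ (T b)_J = Σ_I σ(b_I) ((S′ T) b)_I`, `S′ T = reindex ((S₀ t) ⊗ J′)`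
  have h2 : (∑ I, ∑ J, conjLocal L (IsCMField.complexConj L) v (b I) *
        (LocalSplitting.gramS (Fp L) L v n' (gramR L e' dV hdV (tensorFrame L dW eW dV') (tensorFrame_real L dW hdW eW dV' hdV')) I J *
          (Matrix.reindex (epsV e eW e') (epsV e eW e') (t ⊗ₖ (1 : Matrix (Fin M₂) (Fin M₂) (LocalRing L v))) *ᵥ b) J)) =
      ∑ I, conjLocal L (IsCMField.complexConj L) v (b I) *
        ((LocalSplitting.gramS (Fp L) L v n' (gramR L e' dV hdV (tensorFrame L dW eW dV') (tensorFrame_real L dW hdW eW dV' hdV')) *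
          Matrix.reindex (epsV e eW e') (epsV e eW e') (t ⊗ₖ (1 : Matrix (Fin M₂) (Fin M₂) (LocalRing L v)))) *ᵥ b) I := by
    refine Finset.sum_congr rfl fun I _ => ?_
    rw [← Finset.mul_sum, ← Matrix.mulVec_mulVec]
    rfl
  rw [h2, gramS_tensor L e dV hdV dW hdW eW e' dV' hdV' v, reindex_kronecker_mul, Matrix.mul_one, sum_conj_mul_reindex_kronecker_mulVec, gramLoc,
    localForm_diagonal_eq_gramS L dV' hdV' v]

end CM

end Summit.HodgeConjecture.HodgeConjecture.Cruxes.HLiu418.K2LiuDeltaSpTransportUnipotentValue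

end
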